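import Summits.AtomisticToContinuum.Crystallization.Theses.PerronTransitivity
import Summits.AtomisticToContinuum.Crystallization.Theorems.PerronTransitivityNoFractionalGainStubCoreHeight
import Summits.AtomisticToContinuum.Crystallization.Theorems.PerronTransitivityNoFractionalGainStubMergeReduction
import HarnessLib

/-!
# Line `merge-perron` for crux `PerronTransitivity.NoFractionalGain` (stmt-AtomisticToContinuum-15098)
# — skeleton rev. 4 (lead continuation c2, cycle 3, 2026-08-17): ONE open stub, ABSTRACT level

Crux K* (NO FRACTIONAL GAIN, copositive form), verbatim the route decl
`Summit.AtomisticToContinuum.Crystallization.Theses.PerronTransitivity.NoFractionalGain`: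
for every `N`, every injective `x : Fin N → ℝ³` and every `c : Fin N → ℝ` with `c ≥ 0`,
`2·E*·∑ cᵢ² ≤ ∑_{i ≠ j} cᵢ cⱼ V_LJ(dist xᵢ xⱼ)`, `E* = ⨅_Q e_LJ(Q)` (periodic configurations of `ℝ³`,
Blanc–Lewin units `V_LJ(r) = r⁻¹²/12 − r⁻⁶/6`).  Write `F(x,c) := ∑_{i≠j} cᵢcⱼV(|xᵢ−xⱼ|) − 2E*·|c|²`.

## rev. 4 versus rev. 3 (why the reshape)

rev. 3's single open stub `stub_copositiveKepler` carried the EXPLICIT constant `2·e_LJ(hcp a h)` at an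
e_LJ-optimal hcp scale.  Cycle 2 proved (`copositiveKepler_iff_noFractionalGain_and_hcpLeast`, file
`…NoFractionalGainHeartSize.lean`, p163964) that this explicit form is EQUIVALENT to
`NoFractionalGain ∧ (the optimal hcp crystal is a periodic Lennard-Jones ground state)`, i.e. it is the crux
PLUS the periodic LJ crystal problem with attainment (Blanc–Lewin 2015 §2.3; shared item HcpPeriodicMinimiser
stmt-3061) — strictly harder than the crux.  rev. 4 keeps the line's composition (pile reduction) and gives
the open stub the ABSTRACT level `2E*`: `stub_separatedNoFractionalGain` below is K* on `73/100`-separated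
configurations, which is EQUIVALENT to the crux (`→` is the composition `NoFractionalGain_of`; `←` is
restriction; both directions landed as `noFractionalGain_iff_sep73`, file
`…NoFractionalGainSeparatedForm.lean`, p167324, this cycle).  So the skeleton is honest and minimal: the line
contributes exactly the removal of piles (`r < 0.73`), and its open stub is the crux on separated sets.

## What the line has PROVED (landed, `--supports stmt-AtomisticToContinuum-15098`)

* `stub_mergeReduction` (p158360) + `stub_coreHeight` (p158162): whenever `V(r) ≥ −2E*` on `(0, δ]`,
  deleting one point of a pair closer than `δ` and moving its weight onto the better-placed partner never
  increases `F` (`F(pair) − F(merged) = 2c₂(L₂ − L₁) + 2c₁c₂(V₁₂ + 2E*) ≥ 0`); the tree's Yuhjtman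
  stability constant and `crysEnergyLimit` give `−2E* ≤ 2.386 ≤ V(r)` for `r ≤ 73/100`
  (`V⁻¹(2.386) = 0.733`: the threshold is optimal for that constant; with the true `E* ≈ −0.7176` merging
  would reach `V⁻¹(1.435) = 0.758` and no further — the sliver `(0.758, 2^{-1/6})` is out of reach of every
  pair-local move, worker analysis cycle 1).
* `stub_template` (p157776): an e_LJ-optimal hcp scale exists; `stub_certificate` (p159684): positive
  `Λ`-superharmonic weights certify `cᵀBc ≤ Λ|c|²` (Collatz–Wielandt); true sub-regimes: finite pieces of
  separated hcp (p160355), `Λ`-sub-bound environments (p160884), clusters of `≤ 18` points (p163246),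
  finite subsets of vertex-transitive separated periodic configurations for ALL real weights (p163803),
  finite subsets of separated Barlow stackings under hcp-site domination (p164518) and — this cycle, p167506,
  UNCONDITIONALLY — finite subsets of EVERY Barlow stacking (any Hägg word) with `(a,h)` in the registry box
  `[47/50,1]×[39a/50,17a/20]` for all real weights (`noFractionalGain_on_barlow_subsets_box`: the crux's tightest
  regime), the size theorems of any explicit-constant heart (p159684, p163964).

## The ONE open stub (rev. 4): `stub_separatedNoFractionalGain` = the crux on `73/100`-separated sets

Regime map (strategist / refuter numerics, `STRATEGY-CENSUS.md`, `KSTAR-ATTACK.md`, kit j023343 / j023919 /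
j026318): the weighted quotient `sup_c −cᵀAc/|c|²` over all searched structures is attained by hcp with
UNIFORM weights (`= 2|e_hcp| = 1.43518 =: Λ_hcp ≤ 2|E*|`); Barlow polytypes sit `≤ 1.0·10⁻⁴` below (dhcp
h-sites bound EXACTLY at the hcp level), everything non-Barlow `≤ 0.957 Λ_hcp` (bcc) although single Z16 /
compressed-icosahedral SITES exceed `Λ_hcp` by up to `6.6 %` (so no one-centre bound can prove the stub);
near hcp the uniform weights are a strict local maximiser (second-order Perron gain / phonon stiffness
`= 0.023–0.026`).  A proof of the stub must therefore (i) beat the `10⁻⁵` Barlow margins with the abstract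
`E*` (possible only through identities: row sums of Hägg words versus hcp sites, p164518 + registry signs),
(ii) control weighted perturbations of EVERY Barlow stacking at second order, and (iii) classify all other
separated environments with a many-centre (dressed) bound — a Kepler-scale programme; and `¬`stub is not
certifiable without a proved lower bound `L ≤ E*` within `10⁻⁴` of `e_hcp` (refuter, KSTAR-ATTACK.md).

Disproof.lean: none published for this crux (`ledger crux ls`, 2026-08-17T14:40Z).
-/

noncomputable section

namespace Summit.AtomisticToContinuum.Crystallization.Cruxes.NoFractionalGain.MergePerron

open Literature.MathematicalPhysics.StatisticalMechanics
open Summit.AtomisticToContinuum.Crystallization.Theses.PerronTransitivity (NoFractionalGain)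
open scoped BigOperators

/-- **stub 1 — MERGE REDUCTION (LANDED p158360).**  If the core is at least `−2E*` high on `(0, δ]`,
every weighted configuration `(x, c ≥ 0)` admits a `δ`-SEPARATED weighted configuration `(x', c' ≥ 0)`
whose defect functional `F = ∑_{i≠j} cᵢcⱼV − 2E*|c|²` is not larger. [difficulty: M] -/
theorem stub_mergeReduction : ∀ δ : ℝ, 0 < δ →
    (∀ r : ℝ, 0 < r → r ≤ δ →
      -2 * (⨅ Q : PeriodicConfiguration 3, Q.energyPerParticle lennardJones) ≤ lennardJones r) →
    ∀ (N : ℕ) (x : Fin N → EuclideanSpace ℝ (Fin 3)), Function.Injective x →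
    ∀ c : Fin N → ℝ, (∀ i, 0 ≤ c i) →
    ∃ (N' : ℕ) (x' : Fin N' → EuclideanSpace ℝ (Fin 3)) (c' : Fin N' → ℝ),
      Function.Injective x' ∧ (∀ i j, i ≠ j → δ ≤ dist (x' i) (x' j)) ∧ (∀ i, 0 ≤ c' i) ∧
      (∑ i, ∑ j ∈ Finset.univ.erase i, c' i * c' j * lennardJones (dist (x' i) (x' j))) -
          2 * (⨅ Q : PeriodicConfiguration 3, Q.energyPerParticle lennardJones) * ∑ i, c' i ^ 2 ≤
        (∑ i, ∑ j ∈ Finset.univ.erase i, c i * c j * lennardJones (dist (x i) (x j))) -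
          2 * (⨅ Q : PeriodicConfiguration 3, Q.energyPerParticle lennardJones) * ∑ i, c i ^ 2 :=
  Summit.AtomisticToContinuum.Crystallization.Theorems.PerronTransitivity.NoFractionalGain.stub_mergeReduction

/-- **stub 2 — CORE HEIGHT (LANDED p158162).**  `−2E* ≤ V_LJ(r)` for `0 < r ≤ 73/100`. [difficulty: M] -/
theorem stub_coreHeight : ∀ r : ℝ, 0 < r → r ≤ 73 / 100 →
    -2 * (⨅ Q : PeriodicConfiguration 3, Q.energyPerParticle lennardJones) ≤ lennardJones r :=
  Summit.AtomisticToContinuum.Crystallization.Theorems.PerronTransitivity.NoFractionalGain.stub_coreHeight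

/-- **stub 3 — K* ON SEPARATED CONFIGURATIONS (the heart, XL, OPEN; rev. 4: abstract level; the landed
`stub_template` p157776 and `stub_certificate` p159684 of rev. 1–3 are no longer hypotheses of the
composition and live on as support theorems).**  For
every `73/100`-separated injective finite configuration `x` of `ℝ³` and every non-negative weight vector
`c`, `2·E*·∑ cᵢ² ≤ ∑_{i≠j} cᵢ cⱼ V_LJ(dist xᵢ xⱼ)` with the ABSTRACT level `E* = ⨅_Q e_LJ(Q)`.
EQUIVALENT to the crux (`noFractionalGain_iff_sep73`, landed): the line's pile reduction is all that
separates them.  On `2^{-1/6}`-separated `x` (all pairs attractive) it is the Perron-root bound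
`λ_max[−V_ij] ≤ 2|E*|` and holds for all real `c` as soon as it holds for `c ≥ 0`
(`lj_copositive_iff_allReal_of_separated`, landed p167324); numerically sharp exactly at hcp with uniform weights.
Why it might fail: the crux's own (a bulk competitor with weighted k = 0 Bloch `λ_max > 2|E*|`; Barlow
margins `1e-4`, FK dressed margins `30 %`). [difficulty: XL] -/
theorem stub_separatedNoFractionalGain :
    ∀ (N : ℕ) (x : Fin N → EuclideanSpace ℝ (Fin 3)), Function.Injective x →
      (∀ i j, i ≠ j → (73 : ℝ) / 100 ≤ dist (x i) (x j)) →
      ∀ c : Fin N → ℝ, (∀ i, 0 ≤ c i) →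
        2 * (⨅ Q : PeriodicConfiguration 3, Q.energyPerParticle lennardJones) * ∑ i, c i ^ 2 ≤
          ∑ i, ∑ j ∈ Finset.univ.erase i, c i * c j * lennardJones (dist (x i) (x j)) := by
  sorry

/-! ## Composition (sorry-free) -/

/-- **COMPOSITION** — `stub_mergeReduction → stub_coreHeight → stub_separatedNoFractionalGain →
NoFractionalGain` (the crux BY NAME; real proof, no `sorry`): merge at `δ = 73/100` (core height feeds the
merge hypothesis), then apply the separated bound to the merged configuration. [folklore] -/
theorem NoFractionalGain_of :
    (∀ δ : ℝ, 0 < δ →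
      (∀ r : ℝ, 0 < r → r ≤ δ →
        -2 * (⨅ Q : PeriodicConfiguration 3, Q.energyPerParticle lennardJones) ≤ lennardJones r) →
      ∀ (N : ℕ) (x : Fin N → EuclideanSpace ℝ (Fin 3)), Function.Injective x →
      ∀ c : Fin N → ℝ, (∀ i, 0 ≤ c i) →
      ∃ (N' : ℕ) (x' : Fin N' → EuclideanSpace ℝ (Fin 3)) (c' : Fin N' → ℝ),
        Function.Injective x' ∧ (∀ i j, i ≠ j → δ ≤ dist (x' i) (x' j)) ∧ (∀ i, 0 ≤ c' i) ∧
        (∑ i, ∑ j ∈ Finset.univ.erase i, c' i * c' j * lennardJones (dist (x' i) (x' j))) -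
            2 * (⨅ Q : PeriodicConfiguration 3, Q.energyPerParticle lennardJones) * ∑ i, c' i ^ 2 ≤
          (∑ i, ∑ j ∈ Finset.univ.erase i, c i * c j * lennardJones (dist (x i) (x j))) -
            2 * (⨅ Q : PeriodicConfiguration 3, Q.energyPerParticle lennardJones) * ∑ i, c i ^ 2) →
    (∀ r : ℝ, 0 < r → r ≤ 73 / 100 →
      -2 * (⨅ Q : PeriodicConfiguration 3, Q.energyPerParticle lennardJones) ≤ lennardJones r) →
    (∀ (N : ℕ) (x : Fin N → EuclideanSpace ℝ (Fin 3)), Function.Injective x →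
      (∀ i j, i ≠ j → (73 : ℝ) / 100 ≤ dist (x i) (x j)) →
      ∀ c : Fin N → ℝ, (∀ i, 0 ≤ c i) →
        2 * (⨅ Q : PeriodicConfiguration 3, Q.energyPerParticle lennardJones) * ∑ i, c i ^ 2 ≤
          ∑ i, ∑ j ∈ Finset.univ.erase i, c i * c j * lennardJones (dist (x i) (x j))) →
    Summit.AtomisticToContinuum.Crystallization.Theses.PerronTransitivity.NoFractionalGain := by
  intro hmerge hcore hsep73
  unfold Summit.AtomisticToContinuum.Crystallization.Theses.PerronTransitivity.NoFractionalGain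
  intro N x hx c hc
  obtain ⟨N', x', c', hx', hsep', hc', hF⟩ := hmerge (73 / 100) (by norm_num) hcore N x hx c hc
  have h' := hsep73 N' x' hx' hsep' c' hc'
  linarith

/-- The composition instantiated on the stubs: the crux modulo exactly the `sorry` of
`stub_separatedNoFractionalGain`. [folklore] -/
theorem NoFractionalGain_of_stubs :
    Summit.AtomisticToContinuum.Crystallization.Theses.PerronTransitivity.NoFractionalGain :=
  NoFractionalGain_of stub_mergeReduction stub_coreHeight stub_separatedNoFractionalGain

end Summit.AtomisticToContinuum.Crystallization.Cruxes.NoFractionalGain.MergePerron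

end
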